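import Summits.QuantumAdvantage.AdviceFreeQNC0.FibreDecimation37F4
import HarnessLib

/-!
# Cell qa-qnc0, `p = 3` — ROUND-38P2 §3.6: the CUBE UNCERTAINTY PRINCIPLE (Proposition 38.X, planner p2 g38's typed target
# `Exp38p2.CubeUncertainty`) — PROVED

Planner qa-qnc0-p2 g38, ROUND-38P2 v5 §3.6 (2026-08-29 21:05Z), typed in the custody file `qa-qnc0-p2/exp38p2/SubRowDecimation38.lean`
(sha eb7fc6e465f082df, §3.6 block; ported VERBATIM below — `charCombo`, `CubeUncertainty`, in namespace `…Exp38p2`): a non-zero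
`𝔽₄`-combination `B = Σ_{k<T} ζ_k χ_{δ_k}` of `T` general cube characters (`Exp37.chiDir`, zeros allowed) has at least `2^m/T²` non-zeros
on `{0,1}^m`.

* `cube_uncertainty_card` — the statement for an arbitrary finite index type `κ` (`T = |κ|`), by induction on `m` (p2's three-line proof):
  split the first coin, `B(a :: u') = B_a(u')` with `B_a = Σ_k ζ_k ω^{a·δ_{k,0}} χ_{δ_k⁻}`; if both halves are non-zero somewhere, add the two
  bounds (`card_filter_cons`); if `B_{¬a₀} ≡ 0 ≢ B_{a₀}`, then pointwise `B_{a₀} = B_{a₀} + c·B_{¬a₀}` and for `c = ω^{∓v}` the new coefficient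
  `ζ_k(e_{a₀}(k) + c·e_{¬a₀}(k))` vanishes on `G_v = {k : δ_{k,0} = v}` (characteristic `2`; `coefMix_eq_zero`); with `|G_v| ≥ T/3`
  (pigeonhole, `exists_third_class`) the induction hypothesis on the `≤ 2T/3` remaining terms gives `2^m ≤ (2T/3)²·#supp`, and `2(2T/3)² ≤ T²`.
* **`cubeUncertainty : CubeUncertainty`** — the typed form (`κ = Fin T`).

The cell's statement and proof (planner p2 g38); not in print.  WHAT THIS IS NOT: the sharp exponent `log 2/log(3/2) ≈ 1.71` of the memo is not
recorded (the typed target asks for `2`); Corollary 38.Y and everything about the game are untouched; crux 22907 untouched.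
-/

noncomputable section

open Classical

namespace Summit.QuantumAdvantage.AdviceFreeQNC0.Exp38p2

open Finset
open Summit.QuantumAdvantage.AdviceFreeQNC0 F4
open Summit.QuantumAdvantage.AdviceFreeQNC0.Exp37

/-! ### The typed target (verbatim port of `exp38p2/SubRowDecimation38.lean` v5 §3.6) -/

/-- an `𝔽₄`-combination of `T` general cube characters. -/
def charCombo {m T : ℕ} (ζ : Fin T → F4) (δ : Fin T → Fin m → ZMod 3) (u : Fin m → Bool) : F4 :=
  ∑ k, ζ k * chiDir (δ k) u

/-- **Proposition 38.X (cube uncertainty principle)**, exponent-`2` form: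
`2^m ≤ T² · #{u : Σ_k ζ_k χ_{δ_k}(u) ≠ 0}` whenever the combination is non-zero somewhere.
(Proof in ROUND-38P2 §3.6: induction on `m`; if one half-cube vanishes identically, adding `ω^{-v}`
times it kills the `≥ T/3` rows with last letter `v`.) -/
def CubeUncertainty : Prop :=
  ∀ (m T : ℕ) (ζ : Fin T → F4) (δ : Fin T → Fin m → ZMod 3),
    (∃ u, charCombo ζ δ u ≠ 0) →
      2 ^ m ≤ T ^ 2 * (univ.filter fun u : Fin m → Bool => charCombo ζ δ u ≠ 0).card

/-! ### Splitting the first coin -/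

variable {m : ℕ}

/-- Support size of an `𝔽₄`-valued function on the cube. -/
def suppCard (B : (Fin m → Bool) → F4) : ℕ := (univ.filter fun u => B u ≠ 0).card

/-- `χ_δ(a :: u') = ω^{a·δ₀} · χ_{δ⁻}(u')`. -/
theorem chiDir_cons (δ : Fin (m + 1) → ZMod 3) (a : Bool) (u' : Fin m → Bool) :
    chiDir δ (Fin.cons a u') = (if a then ω ^ (δ 0).val else 1) * chiDir (fun i => δ i.succ) u' := by
  unfold chiDir
  rw [Fin.prod_univ_succ]
  simp only [Fin.cons_zero, Fin.cons_succ]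

/-- The phase `e_a(k) = ω^{a·δ_{k,0}}` of term `k` on the half-cube `a`. -/
def phase {κ : Type} (δ : κ → Fin (m + 1) → ZMod 3) (a : Bool) (k : κ) : F4 :=
  if a then ω ^ (δ k 0).val else 1

/-- The combination `B = Σ_k ζ_k χ_{δ_k}` over an arbitrary index type. -/
def comboK {n : ℕ} {κ : Type} [Fintype κ] (ζ : κ → F4) (δ : κ → Fin n → ZMod 3) (u : Fin n → Bool) : F4 :=
  ∑ k, ζ k * chiDir (δ k) u

/-- **Half-cube restriction**: `B(a :: u') = Σ_k (ζ_k e_a(k)) χ_{δ_k⁻}(u')`. -/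
theorem comboK_cons {κ : Type} [Fintype κ] (ζ : κ → F4) (δ : κ → Fin (m + 1) → ZMod 3) (a : Bool) :
    (fun u' => comboK ζ δ (Fin.cons a u')) = comboK (fun k => ζ k * phase δ a k) (fun k i => δ k i.succ) := by
  funext u'
  unfold comboK
  refine Finset.sum_congr rfl fun k _ => ?_
  rw [chiDir_cons]; unfold phase; ring

/-- Counting over the cube by the first coin: `#supp B = #supp B(ff :: ·) + #supp B(tt :: ·)`. -/
theorem suppCard_succ (B : (Fin (m + 1) → Bool) → F4) :
    suppCard B = suppCard (fun u' => B (Fin.cons false u')) + suppCard (fun u' => B (Fin.cons true u')) := by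
  unfold suppCard
  rw [card_filter, card_filter, card_filter]
  rw [← Fintype.sum_equiv (Fin.consEquiv fun _ : Fin (m + 1) => Bool) (fun p => if B (Fin.cons p.1 p.2) ≠ 0 then 1 else 0)
    (fun u => if B u ≠ 0 then 1 else 0) (fun p => rfl)]
  rw [Fintype.sum_prod_type, Fintype.sum_bool, add_comm]

/-- Every point of the cube is `a :: u'`. -/
theorem exists_cons (u : Fin (m + 1) → Bool) : ∃ (a : Bool) (u' : Fin m → Bool), u = Fin.cons a u' :=
  ⟨u 0, Fin.tail u, (Fin.cons_self_tail u).symm⟩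

/-- A function vanishing everywhere has empty support. -/
theorem suppCard_eq_zero_of_forall (B : (Fin m → Bool) → F4) (h : ∀ u, B u = 0) : suppCard B = 0 := by
  unfold suppCard
  rw [card_eq_zero, filter_eq_empty_iff]
  intro u _; rw [h u]; exact not_not.2 rfl

/-- A function with a non-zero value has non-empty support. -/
theorem one_le_suppCard_of_exists (B : (Fin m → Bool) → F4) (h : ∃ u, B u ≠ 0) : 1 ≤ suppCard B := by
  obtain ⟨u, hu⟩ := h
  exact card_pos.2 ⟨u, mem_filter.2 ⟨mem_univ _, hu⟩⟩

/-! ### The vanishing branch -/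

/-- The mixing constant `c = ω^{−v}` (untwisted half alive) resp. `ω^{v}` (twisted half alive). -/
def mixC (a₀ : Bool) (v : ZMod 3) : F4 := if a₀ then ω ^ v.val else ω ^ (-v).val

/-- **The mixed coefficient vanishes on `G_v`**: `e_{a₀}(k) + c·e_{¬a₀}(k) = 0` when `δ_{k,0} = v`. -/
theorem coefMix_eq_zero {κ : Type} (δ : κ → Fin (m + 1) → ZMod 3) (a₀ : Bool) (v : ZMod 3) (k : κ)
    (hk : δ k 0 = v) : phase δ a₀ k + mixC a₀ v * phase δ (!a₀) k = 0 := by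
  unfold phase mixC
  cases a₀
  · simp only [Bool.false_eq_true, if_false, Bool.not_false, if_true]
    rw [hk, omega_pow_val_add, neg_add_cancel, ZMod.val_zero, pow_zero, add_self]
  · simp only [if_true, Bool.not_true, Bool.false_eq_true, if_false, mul_one, hk, add_self]

/-- **Mixing in a dead half**: if `B_{¬a₀} ≡ 0`, then `B_{a₀}` is the combination over `{k : δ_{k,0} ≠ v}` with the mixed
coefficients. -/
theorem comboK_mix {κ : Type} [Fintype κ] (ζ : κ → F4) (δ : κ → Fin (m + 1) → ZMod 3) (a₀ : Bool) (v : ZMod 3)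
    (hdead : ∀ u', comboK (fun k => ζ k * phase δ (!a₀) k) (fun k i => δ k i.succ) u' = 0) :
    comboK (fun k => ζ k * phase δ a₀ k) (fun k i => δ k i.succ) =
      comboK (fun k' : {k : κ // δ k 0 ≠ v} => ζ k'.1 * (phase δ a₀ k'.1 + mixC a₀ v * phase δ (!a₀) k'.1))
        (fun k' i => δ k'.1 i.succ) := by
  funext u'
  unfold comboK at hdead ⊢
  have e : (∑ k, (ζ k * (phase δ a₀ k + mixC a₀ v * phase δ (!a₀) k)) * chiDir (fun i => δ k i.succ) u') =
      (∑ k, (ζ k * phase δ a₀ k) * chiDir (fun i => δ k i.succ) u') +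
        mixC a₀ v * ∑ k, (ζ k * phase δ (!a₀) k) * chiDir (fun i => δ k i.succ) u' := by
    rw [Finset.mul_sum, ← Finset.sum_add_distrib]
    exact Finset.sum_congr rfl fun k _ => by ring
  rw [hdead u', mul_zero, add_zero] at e
  rw [← e, ← Fintype.sum_subtype_add_sum_subtype (fun k : κ => δ k 0 ≠ v)]
  have hzero : (∑ k : {k : κ // ¬ δ k 0 ≠ v},
      (ζ k.1 * (phase δ a₀ k.1 + mixC a₀ v * phase δ (!a₀) k.1)) * chiDir (fun i => δ k.1 i.succ) u') = 0 := by
    refine Finset.sum_eq_zero fun k _ => ?_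
    rw [coefMix_eq_zero δ a₀ v k.1 (not_not.1 k.2), mul_zero, zero_mul]
  rw [hzero, add_zero]

/-- Pigeonhole on the first letters: some class `G_v = {k : δ_{k,0} = v}` has `3|G_v| ≥ T`. -/
theorem exists_third_class {κ : Type} [Fintype κ] (δ : κ → Fin (m + 1) → ZMod 3) :
    ∃ v : ZMod 3, Fintype.card κ ≤ 3 * (univ.filter fun k => δ k 0 = v).card := by
  by_contra h
  push Not at h
  have hsum : Fintype.card κ = ∑ v : ZMod 3, (univ.filter fun k => δ k 0 = v).card := by
    rw [← card_univ, ← Finset.card_biUnion]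
    · congr 1; ext k; simp
    · intro v _ w _ hvw
      exact disjoint_filter.2 fun k _ h1 h2 => hvw (h1.symm.trans h2)
  have h3 : (∑ v : ZMod 3, (univ.filter fun k => δ k 0 = v).card) =
      (univ.filter fun k => δ k 0 = 0).card + (univ.filter fun k => δ k 0 = 1).card +
        (univ.filter fun k => δ k 0 = 2).card := Fin.sum_univ_three _
  have h0 := h 0
  have h1 := h 1
  have h2 := h 2
  omega

/-! ### The induction -/

/-- **Proposition 38.X for an arbitrary finite index type** (`T = |κ|`): `2^m ≤ |κ|²·#supp B`. -/
theorem cube_uncertainty_card (m : ℕ) : ∀ (κ : Type) [Fintype κ] (ζ : κ → F4) (δ : κ → Fin m → ZMod 3),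
    (∃ u, comboK ζ δ u ≠ 0) → 2 ^ m ≤ Fintype.card κ ^ 2 * suppCard (comboK ζ δ) := by
  induction m with
  | zero =>
    intro κ _ ζ δ hex
    have hκ : 0 < Fintype.card κ := by
      by_contra h0
      push Not at h0
      have : IsEmpty κ := Fintype.card_eq_zero_iff.1 (by omega)
      obtain ⟨u, hu⟩ := hex
      exact hu (by unfold comboK; simp)
    calc 2 ^ 0 = 1 * 1 := by norm_num
      _ ≤ Fintype.card κ ^ 2 * suppCard (comboK ζ δ) :=
        Nat.mul_le_mul (Nat.one_le_pow _ _ hκ) (one_le_suppCard_of_exists _ hex)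
  | succ m ih =>
    intro κ _ ζ δ hex
    rw [suppCard_succ, comboK_cons, comboK_cons]
    by_cases hboth : (∃ u', comboK (fun k => ζ k * phase δ false k) (fun k i => δ k i.succ) u' ≠ 0) ∧
        (∃ u', comboK (fun k => ζ k * phase δ true k) (fun k i => δ k i.succ) u' ≠ 0)
    · -- both halves alive: add
      have h0 := ih κ (fun k => ζ k * phase δ false k) (fun k i => δ k i.succ) hboth.1
      have h1 := ih κ (fun k => ζ k * phase δ true k) (fun k i => δ k i.succ) hboth.2
      rw [pow_succ, mul_add]
      omega
    · -- one half dead: which one is alive?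
      obtain ⟨a₀, halive, hdead⟩ : ∃ a₀ : Bool,
          (∃ u', comboK (fun k => ζ k * phase δ a₀ k) (fun k i => δ k i.succ) u' ≠ 0) ∧
          (∀ u', comboK (fun k => ζ k * phase δ (!a₀) k) (fun k i => δ k i.succ) u' = 0) := by
        obtain ⟨u, hu⟩ := hex
        obtain ⟨a, u', rfl⟩ := exists_cons u
        have hu' : comboK (fun k => ζ k * phase δ a k) (fun k i => δ k i.succ) u' ≠ 0 := by
          rw [← comboK_cons]; exact hu
        refine ⟨a, ⟨u', hu'⟩, ?_⟩
        by_contra hne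
        push Not at hne
        apply hboth
        cases a
        · exact ⟨⟨u', hu'⟩, by simpa using hne⟩
        · exact ⟨by simpa using hne, ⟨u', hu'⟩⟩
      -- pigeonhole class and the restricted index type
      obtain ⟨v, hv⟩ := exists_third_class δ
      have hcard' : Fintype.card {k : κ // δ k 0 ≠ v} = Fintype.card κ - (univ.filter fun k => δ k 0 = v).card := by
        rw [Fintype.card_subtype_compl, Fintype.card_subtype]
      have hih := ih {k : κ // δ k 0 ≠ v}
        (fun k' => ζ k'.1 * (phase δ a₀ k'.1 + mixC a₀ v * phase δ (!a₀) k'.1)) (fun k' i => δ k'.1 i.succ)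
        (by rw [← comboK_mix ζ δ a₀ v hdead]; exact halive)
      rw [← comboK_mix ζ δ a₀ v hdead] at hih
      have hT : 3 * Fintype.card {k : κ // δ k 0 ≠ v} ≤ 2 * Fintype.card κ := by rw [hcard']; omega
      have hsq : 2 * Fintype.card {k : κ // δ k 0 ≠ v} ^ 2 ≤ Fintype.card κ ^ 2 := by nlinarith [hT]
      have hdead0 := suppCard_eq_zero_of_forall _ hdead
      cases a₀
      · simp only [Bool.not_false] at hdead0 hih
        rw [hdead0, add_zero, pow_succ]
        calc 2 ^ m * 2 ≤ Fintype.card {k : κ // δ k 0 ≠ v} ^ 2 * _ * 2 := Nat.mul_le_mul_right 2 hih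
          _ ≤ Fintype.card κ ^ 2 * _ := by nlinarith [hsq]
      · simp only [Bool.not_true] at hdead0 hih
        rw [hdead0, zero_add, pow_succ]
        calc 2 ^ m * 2 ≤ Fintype.card {k : κ // δ k 0 ≠ v} ^ 2 * _ * 2 := Nat.mul_le_mul_right 2 hih
          _ ≤ Fintype.card κ ^ 2 * _ := by nlinarith [hsq]

/-- **Proposition 38.X (cube uncertainty principle, typed form) — PROVED.** -/
theorem cubeUncertainty : CubeUncertainty := by
  intro m T ζ δ hex
  have h := cube_uncertainty_card m (Fin T) ζ δ hex
  rw [Fintype.card_fin] at h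
  exact h

end Summit.QuantumAdvantage.AdviceFreeQNC0.Exp38p2

end
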